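import Literature.NumberTheory.Sieve.DivisorPowerSums
import Literature.NumberTheory.Sieve.Polymath8aDiscrepancy
import HarnessLib

/-!
# Polymath 8a, §3: the short-support error term of the proof of Lemma 2.7, summed over the moduli (via Shiu)

Support file for the named fact `Literature.NumberTheory.Sieve.mpz_of_lt` (**parity.S29**,
`ParityWave0.lean`): D. H. J. Polymath, *New equidistribution estimates of Zhang type*, Algebra &
Number Theory 8:9 (2014) 2067–2199 = arXiv:1402.0811.  In the proof of Lemma 2.7 (§3), replacing
`(μ_≤^{⋆j} ⋆ 1^{⋆(j−1)} ⋆ L) 1_{[x,2x]}` by its finer-than-dyadic expansion costs an error term `α`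
"supported on `[x(1−O(log^{-A₀}x)), x] ∪ [2x, 2x(1+O(log^{-A₀}x))]`" with
`α(n) ≪ τ(n)^{O(1)} (log n)^{O(1)}`, whose discrepancies must contribute `≪ x log^{-A₀+O(1)} x` after
summation over the moduli `q ∈ 𝒬`.  The paper appeals to Lemma 1.3 ("the divisor bound and trivial
estimates"); the estimate that actually delivers the logarithmic saving uniformly over
`q ≤ x^{1/2+2ϖ+ε}` is the Brun–Titchmarsh inequality for `τ^B` on short intervals in progressions —
Shiu's theorem, PROVED in the tree (`Shiu1980BrunTitchmarsh_holds`; specialisation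
`Shiu1980BrunTitchmarsh.sigma_zero_pow`, `DivisorPowerSums.lean`).  This file PROVES the summed
bound from the named fact `Shiu1980BrunTitchmarsh` (taken as a hypothesis to keep the import closure
small):

* `sum_moduli_shortInterval_sigma_zero_pow_le` —
  `∑_{q ∈ S} ∑_{x' < n ≤ x'+y, n ≡ a_q (q)} τ(n)^r ≤ C y (log x')^{2^r−1} (1 + log Q)²` for moduli
  `1 ≤ q ≤ Q`, `q < y^{1−θ}` (Shiu termwise, `∑_{q ≤ Q} 1/φ(q) ≤ (1+log Q)²` = `totientInvSum_le`);
* `sum_moduli_abs_apDiscrepancy_shortSupport_le` — for `β` with `|β(n)| ≤ K τ(n)^B (log x)^B`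
  supported on `(x', x'+y]`: `∑_{q ∈ S} |Δ(β; a_q (q))| ≤ 2KC (log x)^B y (log x')^{2^B−1} (1+log Q)²`
  (`abs_apDiscrepancy_le` + the above + Shiu on the whole interval).  With `y ≍ x log^{-A₀} x` this is
  `≪ x log^{-A₀+O(1)} x`.

Nothing here discharges `mpz_of_lt`.

## References

* D. H. J. Polymath, *New equidistribution estimates of Zhang type*, Algebra & Number Theory 8:9
  (2014), 2067–2199, arXiv:1402.0811: §3, proof of Lemma 2.7 (the error term `α`); Lemma 1.3.
  [cite: Polymath8a2014]
* P. Shiu, *A Brun–Titchmarsh theorem for multiplicative functions*, J. reine angew. Math. 313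
  (1980), 161–170, Theorem 1. [cite: Shiu1980]
-/

open Finset
open scoped ArithmeticFunction.sigma

namespace Literature.NumberTheory.Sieve

namespace Polymath8a

/-- **Shiu's bound summed over a family of moduli**: for `r`, `0 < ε < 1/2`, `0 < θ < 1/2` there are
`C, x₀` such that for `x ≥ x₀`, `x^ε ≤ y ≤ x`, every finite set `S` of moduli `1 ≤ q ≤ Q` with
`q < y^{1−θ}` and reduced residues `a_q`,
`∑_{q ∈ S} ∑_{x < n ≤ x+y, n ≡ a_q (q)} τ(n)^r ≤ C y (log x)^{2^r − 1} (1 + log Q)²`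
(the tree's `Shiu1980BrunTitchmarsh.sigma_zero_pow` termwise and `∑_{q ≤ Q} 1/φ(q) ≤ (1 + log Q)²`,
`totientInvSum_le`).  This is the form in which the short-support error term `α` of the proof of
Polymath 8a Lemma 2.7 (§3: "`α` … is supported on `[x(1−O(log^{-A₀}x)), x] ∪ [2x, 2x(1+O(log^{-A₀}x))]`
… using the divisor bound and trivial estimates … `Δ(α; a (q)) ≪ x log^{-A₀+O(1)} x`") is summed
over the moduli. [cite: Polymath8a2014, §3, proof of Lemma 2.7 (the error term α) with Lemma 1.3] -/
theorem sum_moduli_shortInterval_sigma_zero_pow_le (hS : Shiu1980BrunTitchmarsh) (r : ℕ) {ε θ : ℝ}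
    (hε : 0 < ε) (hε' : ε < 1 / 2) (hθ : 0 < θ) (hθ' : θ < 1 / 2) :
    ∃ C x₀ : ℝ, 0 ≤ C ∧ ∀ x y : ℝ, x₀ ≤ x → x ^ ε ≤ y → y ≤ x →
      ∀ (S : Finset ℕ) (Q : ℕ), (∀ q ∈ S, 1 ≤ q ∧ q ≤ Q ∧ (q : ℝ) < y ^ (1 - θ)) →
      ∀ a : ℕ → ℕ, (∀ q ∈ S, (a q).Coprime q) →
        ∑ q ∈ S, ∑ n ∈ (Icc 1 ⌊x + y⌋₊).filter (fun n : ℕ => x < n ∧ (n : ZMod q) = (a q : ZMod q)),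
            (σ 0 n : ℝ) ^ r ≤ C * y * Real.log x ^ (2 ^ r - 1) * (1 + Real.log Q) ^ 2 := by
  obtain ⟨C, x₀, hC0, hC⟩ := hS.sigma_zero_pow r hε hε' hθ hθ'
  -- make sure `log x ≥ 0` in the range (enlarge `x₀` to at least `1`)
  refine ⟨C, max x₀ 1, hC0, fun x y hx hxy hyx S Q hS' a ha => ?_⟩
  have hx₀ : x₀ ≤ x := le_trans (le_max_left _ _) hx
  have hx1 : 1 ≤ x := le_trans (le_max_right _ _) hx
  have hL : 0 ≤ Real.log x := Real.log_nonneg hx1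
  have hy0 : 0 ≤ y := le_trans (Real.rpow_nonneg (by linarith) ε) hxy
  calc ∑ q ∈ S, ∑ n ∈ (Icc 1 ⌊x + y⌋₊).filter
          (fun n : ℕ => x < n ∧ (n : ZMod q) = (a q : ZMod q)), (σ 0 n : ℝ) ^ r
      ≤ ∑ q ∈ S, C * y / (Nat.totient q : ℝ) * Real.log x ^ (2 ^ r - 1) :=
        Finset.sum_le_sum fun q hq =>
          hC x y hx₀ hxy hyx q (hS' q hq).1 (hS' q hq).2.2 (a q) (ha q hq)
    _ = C * y * Real.log x ^ (2 ^ r - 1) * ∑ q ∈ S, ((Nat.totient q : ℝ))⁻¹ := by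
        rw [Finset.mul_sum]
        exact Finset.sum_congr rfl fun q _ => by rw [div_eq_mul_inv]; ring
    _ ≤ C * y * Real.log x ^ (2 ^ r - 1) * totientInvSum Q := by
        refine mul_le_mul_of_nonneg_left ?_ (by positivity)
        rw [totientInvSum]
        refine Finset.sum_le_sum_of_subset_of_nonneg (fun q hq => ?_) fun _ _ _ => by positivity
        exact Finset.mem_Icc.mpr ⟨(hS' q hq).1, (hS' q hq).2.1⟩
    _ ≤ C * y * Real.log x ^ (2 ^ r - 1) * (1 + Real.log Q) ^ 2 :=
        mul_le_mul_of_nonneg_left (totientInvSum_le Q) (by positivity)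

/-- **The short-support error term, summed over the moduli** (Polymath 8a §3, the function `α` of the
proof of Lemma 2.7).  If `|β(n)| ≤ K τ(n)^B (log x)^B` and `β` is supported on the short interval
`x' < n ≤ x' + y` (`x' ≥ max(x₀, 1)`, `x'^ε ≤ y ≤ x'`, `y > 1`), then for every window `X`, every
finite set `S` of moduli `1 ≤ q ≤ Q` with `q < y^{1−θ}` and reduced residues `a_q`,
`∑_{q ∈ S} |Δ(β; a_q (q))| ≤ 2 K C (log x)^B y (log x')^{2^B − 1} (1 + log Q)²`
(`abs_apDiscrepancy_le`, Shiu in each progression and on the whole interval, `∑ 1/φ(q) ≤ (1+log Q)²`).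
With `y ≍ x log^{-A₀} x` and `Q = x^{1/2+2ϖ+ε}` this is `≪ x log^{-A₀+O(1)} x`, the bound used for
`α` (applied once near `x` and once near `2x`). [cite: Polymath8a2014, §3, proof of Lemma 2.7 (the error term α)] -/
theorem sum_moduli_abs_apDiscrepancy_shortSupport_le (hS : Shiu1980BrunTitchmarsh) (B : ℕ)
    {ε θ : ℝ} (hε : 0 < ε) (hε' : ε < 1 / 2) (hθ : 0 < θ) (hθ' : θ < 1 / 2) :
    ∃ C x₀ : ℝ, 0 ≤ C ∧ ∀ x x' y : ℝ, x₀ ≤ x' → 1 ≤ x' → x' ^ ε ≤ y → y ≤ x' → 1 < y →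
      ∀ (K : ℝ), 0 ≤ K → 0 ≤ Real.log x → ∀ (X : ℕ),
      ∀ β : ℕ → ℝ, (∀ n : ℕ, n ≠ 0 → |β n| ≤ K * (σ 0 n : ℝ) ^ B * Real.log x ^ B) →
        (∀ n : ℕ, β n ≠ 0 → x' < n ∧ (n : ℝ) ≤ x' + y) →
      ∀ (S : Finset ℕ) (Q : ℕ), (∀ q ∈ S, 1 ≤ q ∧ q ≤ Q ∧ (q : ℝ) < y ^ (1 - θ)) →
      ∀ a : ℕ → ℕ, (∀ q ∈ S, (a q).Coprime q) →
        ∑ q ∈ S, |apDiscrepancy β X q (a q : ZMod q)| ≤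
          2 * K * C * Real.log x ^ B * y * Real.log x' ^ (2 ^ B - 1) * (1 + Real.log Q) ^ 2 := by
  obtain ⟨C, x₀, hC0, hC⟩ := sum_moduli_shortInterval_sigma_zero_pow_le hS B hε hε' hθ hθ'
  obtain ⟨C₁, x₁, hC₁0, hC₁⟩ := hS.sigma_zero_pow B hε hε' hθ hθ'
  refine ⟨max C C₁, max x₀ x₁, by positivity, ?_⟩
  intro x x' y hx' hx'1 hxy hyx hy1 K hK hLx X β hβb hβs S Q hS' a ha
  classical
  have hx₀ : x₀ ≤ x' := le_trans (le_max_left _ _) hx'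
  have hx₁ : x₁ ≤ x' := le_trans (le_max_right _ _) hx'
  set L : ℝ := Real.log x with hLdef
  set L' : ℝ := Real.log x' with hL'def
  have hL'0 : 0 ≤ L' := Real.log_nonneg hx'1
  have hy0 : 0 ≤ y := by linarith
  have hlogQ : 0 ≤ (1 + Real.log Q) ^ 2 := sq_nonneg _
  -- the Shiu index sets
  set G : ℕ → ℕ → Finset ℕ := fun q b =>
    (Icc 1 ⌊x' + y⌋₊).filter (fun n : ℕ => x' < n ∧ (n : ZMod q) = (b : ZMod q)) with hG
  have hβle : ∀ n : ℕ, |β n| ≤ K * L ^ B * (σ 0 n : ℝ) ^ B := fun n => by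
    rcases Nat.eq_zero_or_pos n with rfl | hn
    · have h0 : β 0 = 0 := by
        by_contra hne
        have := (hβs 0 hne).1
        push_cast at this
        linarith
      rw [h0, abs_zero]; positivity
    · calc |β n| ≤ K * (σ 0 n : ℝ) ^ B * L ^ B := hβb n hn.ne'
        _ = K * L ^ B * (σ 0 n : ℝ) ^ B := by ring
  have hmemG : ∀ (q b n : ℕ), β n ≠ 0 → ((n : ZMod q) = (b : ZMod q)) → n ∈ G q b := by
    intro q b n hn hres
    obtain ⟨h1, h2⟩ := hβs n hn
    rw [hG, Finset.mem_filter, Finset.mem_Icc]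
    refine ⟨⟨?_, Nat.le_floor h2⟩, h1, hres⟩
    have : (1 : ℝ) < n := lt_of_le_of_lt hx'1 h1
    exact_mod_cast this.le
  -- class sums of `|β|` against Shiu sets
  have hfirst : ∀ q ∈ S, ∑ n ∈ (Icc 1 X).filter (fun n : ℕ => ((n : ℕ) : ZMod q) = (a q : ZMod q)),
      |β n| ≤ K * L ^ B * ∑ n ∈ G q (a q), (σ 0 n : ℝ) ^ B := by
    intro q _
    rw [← Finset.sum_filter_ne_zero, Finset.mul_sum]
    calc ∑ n ∈ ((Icc 1 X).filter (fun n : ℕ => ((n : ℕ) : ZMod q) = (a q : ZMod q))).filter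
            (fun n => |β n| ≠ 0), |β n|
        ≤ ∑ n ∈ ((Icc 1 X).filter (fun n : ℕ => ((n : ℕ) : ZMod q) = (a q : ZMod q))).filter
            (fun n => |β n| ≠ 0), K * L ^ B * (σ 0 n : ℝ) ^ B :=
          Finset.sum_le_sum fun n _ => hβle n
      _ ≤ ∑ n ∈ G q (a q), K * L ^ B * (σ 0 n : ℝ) ^ B := by
          refine Finset.sum_le_sum_of_subset_of_nonneg (fun n hn => ?_) fun _ _ _ => by positivity
          rw [Finset.mem_filter] at hn
          exact hmemG q (a q) n (fun h => hn.2 (by rw [h, abs_zero])) (Finset.mem_filter.mp hn.1).2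
  have hsecond : ∑ n ∈ Icc 1 X, |β n| ≤ K * L ^ B * (C₁ * y * L' ^ (2 ^ B - 1)) := by
    have hsub : ∑ n ∈ Icc 1 X, |β n| ≤ K * L ^ B * ∑ n ∈ G 1 1, (σ 0 n : ℝ) ^ B := by
      rw [← Finset.sum_filter_ne_zero, Finset.mul_sum]
      calc ∑ n ∈ (Icc 1 X).filter (fun n => |β n| ≠ 0), |β n|
          ≤ ∑ n ∈ (Icc 1 X).filter (fun n => |β n| ≠ 0), K * L ^ B * (σ 0 n : ℝ) ^ B :=
            Finset.sum_le_sum fun n _ => hβle n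
        _ ≤ ∑ n ∈ G 1 1, K * L ^ B * (σ 0 n : ℝ) ^ B := by
            refine Finset.sum_le_sum_of_subset_of_nonneg (fun n hn => ?_) fun _ _ _ => by positivity
            rw [Finset.mem_filter] at hn
            exact hmemG 1 1 n (fun h => hn.2 (by rw [h, abs_zero])) (Subsingleton.elim _ _)
    have hShiu1 : ∑ n ∈ G 1 1, (σ 0 n : ℝ) ^ B ≤ C₁ * y / (Nat.totient 1 : ℝ) * L' ^ (2 ^ B - 1) :=
      hC₁ x' y hx₁ hxy hyx 1 le_rfl
        (by rw [Nat.cast_one]; exact Real.one_lt_rpow hy1 (by linarith)) 1 (Nat.coprime_one_right 1)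
    rw [Nat.totient_one, Nat.cast_one, div_one] at hShiu1
    exact hsub.trans (mul_le_mul_of_nonneg_left hShiu1 (by positivity))
  -- per modulus, then sum
  have hper : ∀ q ∈ S, |apDiscrepancy β X q (a q : ZMod q)| ≤
      K * L ^ B * ∑ n ∈ G q (a q), (σ 0 n : ℝ) ^ B +
        K * L ^ B * (C₁ * y * L' ^ (2 ^ B - 1)) * ((Nat.totient q : ℝ))⁻¹ := by
    intro q hq
    refine (abs_apDiscrepancy_le β X q _).trans (add_le_add (hfirst q hq) ?_)
    rw [div_eq_mul_inv]
    exact mul_le_mul_of_nonneg_right hsecond (by positivity)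
  have hinv : ∑ q ∈ S, ((Nat.totient q : ℝ))⁻¹ ≤ (1 + Real.log Q) ^ 2 := by
    calc ∑ q ∈ S, ((Nat.totient q : ℝ))⁻¹ ≤ totientInvSum Q := by
          rw [totientInvSum]
          refine Finset.sum_le_sum_of_subset_of_nonneg (fun q hq => ?_) fun _ _ _ => by positivity
          exact Finset.mem_Icc.mpr ⟨(hS' q hq).1, (hS' q hq).2.1⟩
      _ ≤ (1 + Real.log Q) ^ 2 := totientInvSum_le Q
  have hsumG := hC x' y hx₀ hxy hyx S Q hS' a ha
  calc ∑ q ∈ S, |apDiscrepancy β X q (a q : ZMod q)|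
      ≤ ∑ q ∈ S, (K * L ^ B * ∑ n ∈ G q (a q), (σ 0 n : ℝ) ^ B +
          K * L ^ B * (C₁ * y * L' ^ (2 ^ B - 1)) * ((Nat.totient q : ℝ))⁻¹) :=
        Finset.sum_le_sum hper
    _ = K * L ^ B * (∑ q ∈ S, ∑ n ∈ G q (a q), (σ 0 n : ℝ) ^ B) +
          K * L ^ B * (C₁ * y * L' ^ (2 ^ B - 1)) * ∑ q ∈ S, ((Nat.totient q : ℝ))⁻¹ := by
        rw [Finset.sum_add_distrib, ← Finset.mul_sum, ← Finset.mul_sum]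
    _ ≤ K * L ^ B * (C * y * L' ^ (2 ^ B - 1) * (1 + Real.log Q) ^ 2) +
          K * L ^ B * (C₁ * y * L' ^ (2 ^ B - 1)) * (1 + Real.log Q) ^ 2 :=
        add_le_add (mul_le_mul_of_nonneg_left hsumG (by positivity))
          (mul_le_mul_of_nonneg_left hinv (by positivity))
    _ = K * (C + C₁) * L ^ B * y * L' ^ (2 ^ B - 1) * (1 + Real.log Q) ^ 2 := by ring
    _ ≤ 2 * K * max C C₁ * L ^ B * y * L' ^ (2 ^ B - 1) * (1 + Real.log Q) ^ 2 := by
        have hCC : C + C₁ ≤ 2 * max C C₁ := by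
          linarith [le_max_left C C₁, le_max_right C C₁]
        have h0 : 0 ≤ K * L ^ B * y * L' ^ (2 ^ B - 1) * (1 + Real.log Q) ^ 2 := by positivity
        calc K * (C + C₁) * L ^ B * y * L' ^ (2 ^ B - 1) * (1 + Real.log Q) ^ 2
            = (C + C₁) * (K * L ^ B * y * L' ^ (2 ^ B - 1) * (1 + Real.log Q) ^ 2) := by ring
          _ ≤ (2 * max C C₁) * (K * L ^ B * y * L' ^ (2 ^ B - 1) * (1 + Real.log Q) ^ 2) :=
              mul_le_mul_of_nonneg_right hCC h0
          _ = _ := by ring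

end Polymath8a

end Literature.NumberTheory.Sieve
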